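import Literature.Analysis.DeBrangesSpaces.BurnolSonineStructureFunction
import Literature.NumberTheory.ConnesConsani2021.SoninSpaceInfiniteDimensional
import Literature.NumberTheory.LFunctions.BurnolZetaSystemsProofs
import HarnessLib

/-!
# Burnol 2002 (CRAS 335), Lemme 2: `K_λ = ker(P_λ + P̃_λ)` and the orthogonal projection onto
# `G_λ = P_λ(L²)^{pair} + P̃_λ(L²)^{pair}` — proofs

LABEL (line 1): **RH-FREE** — Hilbert-space geometry of the two cutoff projections `P_λ`
(multiplication by `𝟙_{[−λ,λ]}`) and `P̃_λ = 𝓕⁻¹P_λ𝓕` on `L²(ℝ)`; `ζ` does not occur. bears_on: LADDER-RH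
COLUMN 6 (DBR), B-C, as corpus vocabulary only. WHAT THIS IS NOT: not a route, not a criterion; nothing
here bears on the truth of RH.

This is a PROOF-ONLY companion of `BurnolSonineStructureFunction.lean` (J.-F. Burnol, *Sur les
« espaces de Sonine » associés par de Branges à la transformation de Fourier*, C. R. Math. Acad. Sci.
Paris **335** (2002) 689–692 = arXiv:math/0208121 [Burnol2002CRAS], TeX of record
`dbl/src/Burnol2002CRAS_arXivmath0208121.tex`). It DISCHARGES the named fact `Burnol2002CRAS_lem2`
(Lemme 2, TeX l.268–278), as typed there (`λ > 0`, `P = cutoffProj λ`, `P̃ = cutoffProjHat λ`,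
`K_λ = sonineK λ`, `G_λ = Gspace λ`):

* (i) for even `f`: `f ∈ K_λ ↔ (P + P̃) f = 0`;
* (ii) for even `f` there is a unique `k ∈ G_λ` with `(P + P̃) k = (P + P̃) f`;
* (iii) such a `k` is the orthogonal projection of `f` onto `G_λ`: `f − k ∈ K_λ` and `f − k ⊥ G_λ`.

## The argument

Burnol's printed proof (TeX l.276–288): "Si `P_λ(f) + P̃_λ(f) = 0` alors `g = P_λ(f) = −P̃_λ(f) = 0` et
`f` est dans `K_λ`. Donc si `k ∈ G_λ` a la même image sous `P_λ + P̃_λ` que `f` alors `f − k` est dans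
`K_λ` et `k` est la projection orthogonale de `f` sur `G_λ`"; the invertibility of `P_λ + P̃_λ` on
`G_λ` is obtained in print from the explicit inverse of `(u,v) ↦ (u + F_λ v, F_λ u + v)` through
`(1 − D_λ)^{-1}`, `F_λ = P_λ𝓕₊P_λ` "compact auto-adjoint de norme strictement inférieure à `1`".

We follow the first two sentences verbatim — (i): `⟪f, Pf + P̃f⟫ = ‖Pf‖² + ‖P̃f‖²`, and
`K_λ = ker P ∩ ker P̃` on even classes (`sonineK_eq_soninSpace` + `mem_soninSpace_iff_cutoffProj`);
(iii) and the uniqueness half of (ii): `ker P ∩ ker P̃ = (ran P ⊔ ran P̃)ᗮ ⊥ G_λ`. For the EXISTENCE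
half of (ii) we deviate from print only in packaging: instead of the `2 × 2` operator inverse we use the
same analytic input "`‖P_λ𝓕₊P_λ‖ < 1`" in the form landed by the Connes–Consani cell
(`Literature.NumberTheory.ConnesConsani2021.norm_cutoffProj_comp_cutoffProjHat_lt_one`,
`….isClosed_range_cutoffProj_sup_range_cutoffProjHat`: `ran P ⊔ ran P̃` is CLOSED), take `k` = the
orthogonal projection of `f` onto that closed subspace, and symmetrise: the subspace and its orthogonal
complement are stable under the reflection `x ↦ −x` (`compNeg_cutoffProj`, `compNeg_cutoffProjHat`), so
the projection of an even `f` is even and is `P u + P̃ v` with EVEN `u, v` — i.e. lies in `G_λ` as typed.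

No definitions, no new named facts (D-0026).

## References
* [Burnol2002CRAS] J.-F. Burnol, C. R. Math. Acad. Sci. Paris 335 (2002) 689–692 = arXiv:math/0208121,
  Lemme 2 and its proof (TeX l.268–288).
* [Burnol2004] J.-F. Burnol, *On Fourier and Zeta(s)*, Forum Math. 16 (2004), §6 (closedness of
  `L²(0,λ) + 𝓕₊L²(0,λ)` from `‖P_λ𝓕₊P_λ‖ < 1`; tree file `SoninSpaceInfiniteDimensional.lean`).
-/

noncomputable section

open _root_.MeasureTheory _root_.Complex _root_.Set _root_.Filter
open scoped Real Topology FourierTransform InnerProductSpace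
open Literature.NumberTheory.LFunctions (evenL2 sonineK sonineK_eq_soninSpace)
open Literature.NumberTheory.ConnesConsani2021 (cutoffProj cutoffProjHat soninSpace evenPart
  mem_soninSpace_iff_cutoffProj isStarProjection_cutoffProj isStarProjection_cutoffProjHat
  compNeg_cutoffProj compNeg_cutoffProjHat isClosed_range_cutoffProj_sup_range_cutoffProjHat
  mem_evenPart_iff)
open Literature.Analysis.Fourier (coeFn_compNeg compNeg_compNeg)

namespace Literature.Analysis.DeBrangesSpaces

namespace Burnol2002

/-! ## Abstract tools: star projections, kernels and ranges -/

section Abstract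

variable {E : Type*} [NormedAddCommGroup E] [InnerProductSpace ℂ E] [CompleteSpace E]

/-- For a star projection `Q`, `Re ⟪x, Q x⟫ = ‖Q x‖²`. [folklore] -/
private theorem re_inner_apply_of_isStarProjection {Q : E →L[ℂ] E} (hQ : IsStarProjection Q)
    (x : E) : RCLike.re ⟪x, Q x⟫_ℂ = ‖Q x‖ ^ 2 := by
  have hQs := hQ.isSelfAdjoint.isSymmetric
  have h1 : Q (Q x) = Q x := congrArg (fun R : E →L[ℂ] E => R x) hQ.isIdempotentElem.eq
  have h2 : ⟪x, Q x⟫_ℂ = ⟪Q x, Q x⟫_ℂ := by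
    calc ⟪x, Q x⟫_ℂ = ⟪x, Q (Q x)⟫_ℂ := by rw [h1]
      _ = ⟪Q x, Q x⟫_ℂ := (hQs x (Q x)).symm
  rw [h2]
  exact inner_self_eq_norm_sq (𝕜 := ℂ) (Q x)

/-- **"Si `P(f) + P̃(f) = 0` alors `P(f) = −P̃(f) = 0`"** (TeX l.276), for any two star projections:
`P x + Q x = 0 → P x = 0 ∧ Q x = 0` (`⟪x, Px + Qx⟫ = ‖Px‖² + ‖Qx‖²`). [folklore] -/
private theorem apply_eq_zero_of_add_apply_eq_zero {P Q : E →L[ℂ] E} (hP : IsStarProjection P)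
    (hQ : IsStarProjection Q) {x : E} (h : P x + Q x = 0) : P x = 0 ∧ Q x = 0 := by
  have hre : RCLike.re ⟪x, P x + Q x⟫_ℂ = ‖P x‖ ^ 2 + ‖Q x‖ ^ 2 := by
    rw [inner_add_right, map_add, re_inner_apply_of_isStarProjection hP,
      re_inner_apply_of_isStarProjection hQ]
  rw [h, inner_zero_right, map_zero] at hre
  have h0 := (add_eq_zero_iff_of_nonneg (sq_nonneg _) (sq_nonneg _)).1 hre.symm
  exact ⟨norm_eq_zero.1 (pow_eq_zero_iff two_ne_zero |>.1 h0.1),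
    norm_eq_zero.1 (pow_eq_zero_iff two_ne_zero |>.1 h0.2)⟩

/-- For a star projection `P` and `z ⊥ ran P`: `P z = 0`. [folklore] -/
private theorem apply_eq_zero_of_mem_orthogonal_range {P : E →L[ℂ] E} (hP : IsStarProjection P)
    {z : E} (hz : z ∈ P.rangeᗮ) : P z = 0 := by
  have h1 : ⟪P z, z⟫_ℂ = 0 :=
    Submodule.inner_right_of_mem_orthogonal (LinearMap.mem_range_self (P : E →ₗ[ℂ] E) z) hz
  have h2 : RCLike.re ⟪z, P z⟫_ℂ = ‖P z‖ ^ 2 := re_inner_apply_of_isStarProjection hP z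
  rw [← inner_conj_symm, h1, map_zero, map_zero] at h2
  exact norm_eq_zero.1 (sq_eq_zero_iff.1 h2.symm)

/-- For a star projection `P` with `P z = 0`: `z ⊥ ran P`. [folklore] -/
private theorem mem_orthogonal_range_of_apply_eq_zero {P : E →L[ℂ] E} (hP : IsStarProjection P)
    {z : E} (hz : P z = 0) : z ∈ P.rangeᗮ := by
  rw [Submodule.mem_orthogonal]
  rintro u ⟨w, rfl⟩
  have hPs := hP.isSelfAdjoint.isSymmetric
  calc ⟪P w, z⟫_ℂ = ⟪w, P z⟫_ℂ := hPs w z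
    _ = 0 := by rw [hz, inner_zero_right]

/-- `(ran P ⊔ ran Q)ᗮ = ker P ∩ ker Q` for star projections. [folklore] -/
private theorem mem_orthogonal_sup_range_iff {P Q : E →L[ℂ] E} (hP : IsStarProjection P)
    (hQ : IsStarProjection Q) (z : E) :
    z ∈ (P.range ⊔ Q.range)ᗮ ↔ P z = 0 ∧ Q z = 0 := by
  rw [← Submodule.inf_orthogonal, Submodule.mem_inf]
  exact ⟨fun h ↦ ⟨apply_eq_zero_of_mem_orthogonal_range hP h.1,
      apply_eq_zero_of_mem_orthogonal_range hQ h.2⟩,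
    fun h ↦ ⟨mem_orthogonal_range_of_apply_eq_zero hP h.1,
      mem_orthogonal_range_of_apply_eq_zero hQ h.2⟩⟩

end Abstract

/-! ## The pair `P_λ`, `P̃_λ` on `L²(ℝ)`: evenness bookkeeping -/

/-- `sumProj λ f = P_λ f + P̃_λ f`. [cite: Burnol2002CRAS, Lemme 2 (TeX l.268–274)] -/
theorem sumProj_apply (lam : ℝ) (f : Lp ℂ 2 (volume : Measure ℝ)) :
    sumProj lam f = cutoffProj lam f + cutoffProjHat lam f := rfl

/-- Burnol's even classes `evenL2` are Connes–Consani's `evenPart` (same carrier). [folklore] -/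
private theorem mem_evenL2_iff {f : Lp ℂ 2 (volume : Measure ℝ)} : f ∈ evenL2 ↔ f ∈ evenPart :=
  Iff.rfl

/-- **`K_λ = ker P_λ ∩ ker P̃_λ` on even classes** (de Branges' Sonine space through the dedup bridge
`sonineK_eq_soninSpace` and `mem_soninSpace_iff_cutoffProj`). [cite: Burnol2002CRAS, Lemme 2 (TeX l.268–270)] -/
theorem mem_sonineK_iff_cutoffProj {lam : ℝ} {f : Lp ℂ 2 (volume : Measure ℝ)} :
    f ∈ sonineK lam ↔ f ∈ evenL2 ∧ cutoffProj lam f = 0 ∧ cutoffProjHat lam f = 0 := by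
  rw [sonineK_eq_soninSpace lam, SetLike.mem_coe, mem_soninSpace_iff_cutoffProj, mem_evenL2_iff]

/-- An `L²` class fixed by the reflection `x ↦ −x` is even. [folklore] -/
private theorem mem_evenL2_of_compNeg_eq {u : Lp ℂ 2 (volume : Measure ℝ)}
    (hu : Lp.compMeasurePreserving (fun x : ℝ ↦ -x) (Measure.measurePreserving_neg (volume : Measure ℝ))
      u = u) : u ∈ evenL2 := by
  have h := coeFn_compNeg (F := ℂ) u
  rw [hu] at h
  filter_upwards [h] with x hx
  exact hx.symm

/-- An even `L²` class is fixed by the reflection. [folklore] -/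
private theorem compNeg_eq_of_mem_evenL2 {u : Lp ℂ 2 (volume : Measure ℝ)} (hu : u ∈ evenL2) :
    Lp.compMeasurePreserving (fun x : ℝ ↦ -x) (Measure.measurePreserving_neg (volume : Measure ℝ))
      u = u := by
  refine Lp.ext ?_
  filter_upwards [coeFn_compNeg (F := ℂ) u, hu] with x hx he
  rw [hx, he]

/-- `P_λ u` is even for even `u`. [folklore] -/
private theorem cutoffProj_mem_evenL2 (lam : ℝ) {u : Lp ℂ 2 (volume : Measure ℝ)} (hu : u ∈ evenL2) :
    cutoffProj lam u ∈ evenL2 :=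
  mem_evenL2_of_compNeg_eq (by rw [compNeg_cutoffProj, compNeg_eq_of_mem_evenL2 hu])

/-- `P̃_λ v` is even for even `v`. [folklore] -/
private theorem cutoffProjHat_mem_evenL2 (lam : ℝ) {v : Lp ℂ 2 (volume : Measure ℝ)}
    (hv : v ∈ evenL2) : cutoffProjHat lam v ∈ evenL2 :=
  mem_evenL2_of_compNeg_eq (by rw [compNeg_cutoffProjHat, compNeg_eq_of_mem_evenL2 hv])

/-- Elements of `G_λ` are even. [cite: Burnol2002CRAS, §3 (TeX l.265–266)] -/
theorem mem_evenL2_of_mem_Gspace {lam : ℝ} {k : Lp ℂ 2 (volume : Measure ℝ)} (hk : k ∈ Gspace lam) :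
    k ∈ evenL2 := by
  obtain ⟨u, v, hu, hv, rfl⟩ := hk
  exact evenPart.add_mem (cutoffProj_mem_evenL2 lam hu) (cutoffProjHat_mem_evenL2 lam hv)

/-- `G_λ ⊆ ran P_λ ⊔ ran P̃_λ`. [cite: Burnol2002CRAS, §3 (TeX l.265–266)] -/
theorem mem_sup_range_of_mem_Gspace {lam : ℝ} {k : Lp ℂ 2 (volume : Measure ℝ)}
    (hk : k ∈ Gspace lam) : k ∈ (cutoffProj lam).range ⊔ (cutoffProjHat lam).range := by
  obtain ⟨u, v, -, -, rfl⟩ := hk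
  exact Submodule.add_mem _ (Submodule.mem_sup_left (LinearMap.mem_range_self _ u))
    (Submodule.mem_sup_right (LinearMap.mem_range_self _ v))

/-! ## Lemme 2 (i): `K_λ = ker (P_λ + P̃_λ)` on even classes -/

/-- **Lemme 2, first sentence**: for an even `f`, `f ∈ K_λ ↔ (P_λ + P̃_λ) f = 0` ("Si
`P_λ(f) + P̃_λ(f) = 0` alors `g = P_λ(f) = −P̃_λ(f) = 0` et `f` est dans `K_λ`", TeX l.276–277).
[cite: Burnol2002CRAS, Lemme 2 (TeX l.268–270, 276–277)] -/
theorem mem_sonineK_iff_sumProj_eq_zero (lam : ℝ) {f : Lp ℂ 2 (volume : Measure ℝ)}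
    (hf : f ∈ evenL2) : f ∈ sonineK lam ↔ sumProj lam f = 0 := by
  rw [mem_sonineK_iff_cutoffProj, sumProj_apply]
  constructor
  · rintro ⟨-, h1, h2⟩
    rw [h1, h2, add_zero]
  · intro h
    exact ⟨hf, apply_eq_zero_of_add_apply_eq_zero (isStarProjection_cutoffProj lam)
      (isStarProjection_cutoffProjHat lam) h⟩

/-! ## Lemme 2 (iii): same image under `P_λ + P̃_λ` ⟹ orthogonal projection -/

/-- **Lemme 2, second sentence**: if `f` is even, `k ∈ G_λ` and `(P_λ + P̃_λ)k = (P_λ + P̃_λ)f`, then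
`f − k ∈ K_λ` and `f − k ⊥ G_λ` ("Donc si `k ∈ G_λ` a la même image sous `P_λ + P̃_λ` que `f` alors
`f − k` est dans `K_λ` et `k` est la projection orthogonale de `f` sur `G_λ`", TeX l.277–278).
[cite: Burnol2002CRAS, Lemme 2 (TeX l.272–278)] -/
theorem sub_mem_sonineK_and_orthogonal (lam : ℝ) {f : Lp ℂ 2 (volume : Measure ℝ)}
    (hf : f ∈ evenL2) {k : Lp ℂ 2 (volume : Measure ℝ)} (hk : k ∈ Gspace lam)
    (hkf : sumProj lam k = sumProj lam f) :
    f - k ∈ sonineK lam ∧ ∀ g ∈ Gspace lam, inner ℂ (f - k) g = 0 := by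
  have heven : f - k ∈ evenL2 := evenPart.sub_mem hf (mem_evenL2_of_mem_Gspace hk)
  have hsum : sumProj lam (f - k) = 0 := by rw [map_sub, hkf, sub_self]
  have hker := apply_eq_zero_of_add_apply_eq_zero (isStarProjection_cutoffProj lam)
    (isStarProjection_cutoffProjHat lam) (by rwa [sumProj_apply] at hsum)
  refine ⟨mem_sonineK_iff_cutoffProj.2 ⟨heven, hker⟩, fun g hg ↦ ?_⟩
  have horth : f - k ∈ ((cutoffProj lam).range ⊔ (cutoffProjHat lam).range)ᗮ :=
    (mem_orthogonal_sup_range_iff (isStarProjection_cutoffProj lam)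
      (isStarProjection_cutoffProjHat lam) _).2 hker
  exact Submodule.inner_left_of_mem_orthogonal (mem_sup_range_of_mem_Gspace hg) horth

/-! ## Lemme 2 (ii): `P_λ + P̃_λ` restricted to `G_λ` is invertible -/

/-- **Uniqueness**: two elements of `G_λ` with the same image under `P_λ + P̃_λ` are equal
(`G_λ ∩ K_λ ⊆ W ∩ Wᗮ = 0`, `W = ran P_λ ⊔ ran P̃_λ`). [cite: Burnol2002CRAS, Lemme 2 (TeX l.270–272)] -/
theorem eq_of_mem_Gspace_of_sumProj_eq (lam : ℝ) {k k' : Lp ℂ 2 (volume : Measure ℝ)}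
    (hk : k ∈ Gspace lam) (hk' : k' ∈ Gspace lam) (h : sumProj lam k = sumProj lam k') : k = k' := by
  set W : Submodule ℂ (Lp ℂ 2 (volume : Measure ℝ)) :=
    (cutoffProj lam).range ⊔ (cutoffProjHat lam).range with hW
  have hdW : k - k' ∈ W := W.sub_mem (mem_sup_range_of_mem_Gspace hk) (mem_sup_range_of_mem_Gspace hk')
  have hsum : cutoffProj lam (k - k') + cutoffProjHat lam (k - k') = 0 := by
    rw [← sumProj_apply, map_sub, h, sub_self]
  have hker := apply_eq_zero_of_add_apply_eq_zero (isStarProjection_cutoffProj lam)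
    (isStarProjection_cutoffProjHat lam) hsum
  have hdWo : k - k' ∈ Wᗮ :=
    (mem_orthogonal_sup_range_iff (isStarProjection_cutoffProj lam)
      (isStarProjection_cutoffProjHat lam) _).2 hker
  have h0 : k - k' = 0 := by
    have := Submodule.mem_inf.mpr ⟨hdW, hdWo⟩
    rwa [Submodule.inf_orthogonal_eq_bot, Submodule.mem_bot] at this
  exact sub_eq_zero.1 h0

/-- **Existence**: for an even `f` there is `k ∈ G_λ` with `(P_λ + P̃_λ)k = (P_λ + P̃_λ)f` — the
orthogonal projection of `f` onto the CLOSED subspace `ran P_λ ⊔ ran P̃_λ` (closed because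
`‖P_λ P̃_λ‖ < 1`, Burnol: "`F_λ = P_λ𝓕₊P_λ` compact auto-adjoint de norme strictement inférieure à `1`",
TeX l.283–284), which is even and of the form `P_λ u + P̃_λ v` with even `u, v` since both projections
commute with the reflection. [cite: Burnol2002CRAS, Lemme 2 (TeX l.270–272, 279–288)] -/
theorem exists_mem_Gspace_sumProj_eq {lam : ℝ} {f : Lp ℂ 2 (volume : Measure ℝ)} (hf : f ∈ evenL2) :
    ∃ k ∈ Gspace lam, sumProj lam k = sumProj lam f := by
  set R : Lp ℂ 2 (volume : Measure ℝ) →+ Lp ℂ 2 (volume : Measure ℝ) :=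
    Lp.compMeasurePreserving (fun x : ℝ ↦ -x) (Measure.measurePreserving_neg (volume : Measure ℝ))
    with hRdef
  set P := cutoffProj lam with hPdef
  set Q := cutoffProjHat lam with hQdef
  have hP : IsStarProjection P := isStarProjection_cutoffProj lam
  have hQ : IsStarProjection Q := isStarProjection_cutoffProjHat lam
  set W : Submodule ℂ (Lp ℂ 2 (volume : Measure ℝ)) := P.range ⊔ Q.range with hWdef
  have hWc : IsClosed (W : Set (Lp ℂ 2 (volume : Measure ℝ))) :=
    isClosed_range_cutoffProj_sup_range_cutoffProjHat lam lam
  haveI : CompleteSpace W := hWc.completeSpace_coe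
  set k : Lp ℂ 2 (volume : Measure ℝ) := W.starProjection f with hkdef
  have hkW : k ∈ W := Submodule.starProjection_apply_mem W f
  have hfk : f - k ∈ Wᗮ := Submodule.sub_starProjection_mem_orthogonal f
  -- `W` and `Wᗮ` are stable under the reflection
  have hRW : ∀ w ∈ W, R w ∈ W := by
    intro w hw
    obtain ⟨p, hp, q, hq, rfl⟩ := Submodule.mem_sup.mp hw
    obtain ⟨x, rfl⟩ := LinearMap.mem_range.mp hp
    obtain ⟨y, rfl⟩ := LinearMap.mem_range.mp hq
    rw [map_add]
    refine Submodule.add_mem _ (Submodule.mem_sup_left ?_) (Submodule.mem_sup_right ?_)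
    · exact LinearMap.mem_range.mpr ⟨R x, (compNeg_cutoffProj lam x).symm⟩
    · exact LinearMap.mem_range.mpr ⟨R y, (compNeg_cutoffProjHat lam y).symm⟩
  have hRWo : ∀ z ∈ Wᗮ, R z ∈ Wᗮ := by
    intro z hz
    obtain ⟨hPz, hQz⟩ := (mem_orthogonal_sup_range_iff hP hQ z).1 hz
    refine (mem_orthogonal_sup_range_iff hP hQ (R z)).2 ⟨?_, ?_⟩
    · change cutoffProj lam (R z) = 0
      rw [← compNeg_cutoffProj, show cutoffProj lam z = 0 from hPz, map_zero]
    · change cutoffProjHat lam (R z) = 0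
      rw [← compNeg_cutoffProjHat, show cutoffProjHat lam z = 0 from hQz, map_zero]
  -- hence `k` is fixed by the reflection
  have hRf : R f = f := compNeg_eq_of_mem_evenL2 hf
  have hRk : R k = k := by
    have h1 : R k ∈ W := hRW k hkW
    have h2 : f - R k ∈ Wᗮ := by
      have := hRWo _ hfk
      rwa [map_sub, hRf] at this
    exact (Submodule.eq_starProjection_of_mem_orthogonal h1 h2).symm
  -- write `k = P x + Q y` and symmetrise
  obtain ⟨p, hp, q, hq, hpq⟩ := Submodule.mem_sup.mp hkW
  obtain ⟨x, rfl⟩ := LinearMap.mem_range.mp hp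
  obtain ⟨y, rfl⟩ := LinearMap.mem_range.mp hq
  have hpq' : P x + Q y = k := hpq
  set u : Lp ℂ 2 (volume : Measure ℝ) := (2 : ℂ)⁻¹ • (x + R x) with hudef
  set v : Lp ℂ 2 (volume : Measure ℝ) := (2 : ℂ)⁻¹ • (y + R y) with hvdef
  have hRR : ∀ z : Lp ℂ 2 (volume : Measure ℝ), R (R z) = z := fun z ↦ compNeg_compNeg (F := ℂ) z
  have hu : u ∈ evenL2 := by
    have h2 : x + R x ∈ evenL2 := mem_evenL2_of_compNeg_eq (by rw [map_add, hRR, add_comm])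
    exact evenPart.smul_mem _ h2
  have hv : v ∈ evenL2 := by
    have h2 : y + R y ∈ evenL2 := mem_evenL2_of_compNeg_eq (by rw [map_add, hRR, add_comm])
    exact evenPart.smul_mem _ h2
  have hk_eq : k = P u + Q v := by
    have hRk' : P (R x) + Q (R y) = k := by
      have := congrArg R hpq'
      rw [map_add, hRk] at this
      rw [← this]
      change cutoffProj lam (R x) + cutoffProjHat lam (R y) = R (cutoffProj lam x) + R (cutoffProjHat lam y)
      rw [compNeg_cutoffProj, compNeg_cutoffProjHat]
    rw [hudef, hvdef, map_smul, map_smul, ← smul_add, map_add, map_add,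
      show P x + P (R x) + (Q y + Q (R y)) = (P x + Q y) + (P (R x) + Q (R y)) by abel, hpq', hRk',
      ← two_smul ℂ k, smul_smul, inv_mul_cancel₀ (two_ne_zero' ℂ), one_smul]
  refine ⟨k, ⟨u, v, hu, hv, hk_eq⟩, ?_⟩
  -- same image under `P + Q`: `f − k ∈ Wᗮ = ker P ∩ ker Q`
  obtain ⟨hPfk, hQfk⟩ := (mem_orthogonal_sup_range_iff hP hQ _).1 hfk
  have h1 : P k = P f := by
    have := hPfk; rw [map_sub, sub_eq_zero] at this; exact this.symm
  have h2 : Q k = Q f := by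
    have := hQfk; rw [map_sub, sub_eq_zero] at this; exact this.symm
  rw [sumProj_apply, sumProj_apply]
  change P k + Q k = P f + Q f
  rw [h1, h2]

/-! ## The discharge -/

/-- **Discharge of `Burnol2002CRAS_lem2`** (Burnol 2002, Lemme 2, as typed): for `λ > 0`, (i) an even
`f` lies in `K_λ` iff `(P_λ + P̃_λ)f = 0`; (ii) for every even `f` there is a unique `k ∈ G_λ` with
`(P_λ + P̃_λ)k = (P_λ + P̃_λ)f`; (iii) that `k` satisfies `f − k ∈ K_λ` and `f − k ⊥ G_λ`.
[cite: Burnol2002CRAS, Lemme 2 (TeX l.268–278)] -/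
theorem Burnol2002CRAS_lem2_holds : Burnol2002CRAS_lem2 := by
  intro lam _
  refine ⟨fun f hf ↦ mem_sonineK_iff_sumProj_eq_zero lam hf, fun f hf ↦ ?_,
    fun f hf k hk hkf ↦ sub_mem_sonineK_and_orthogonal lam hf hk hkf⟩
  obtain ⟨k, hk, hkf⟩ := exists_mem_Gspace_sumProj_eq (lam := lam) hf
  exact ⟨k, ⟨hk, hkf⟩, fun k' hk' ↦ eq_of_mem_Gspace_of_sumProj_eq lam hk'.1 hk (hk'.2.trans hkf.symm)⟩

end Burnol2002

end Literature.Analysis.DeBrangesSpaces
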